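import Mathlib
import Literature.Geometry.Lorentzian.KerrSchildCoord
import Literature.Geometry.Lorentzian.KerrConvergence
import Literature.Geometry.Lorentzian.KerrSchildNullBicharacteristic
import Summits.FinalStateConjecture.FinalStateConjecture.Theorems.ClusterCompletenessRecedingDopplerBudgetAlgebra
import Summits.FinalStateConjecture.FinalStateConjecture.Theorems.ClusterCompletenessRecedingDopplerBudgetField
import Summits.FinalStateConjecture.FinalStateConjecture.Theorems.ClusterCompletenessRecedingDopplerBudgetZones
import Summits.FinalStateConjecture.FinalStateConjecture.Theorems.ClusterCompletenessRecedingDopplerBudgetRayA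

/-!
# Route ClusterCompleteness — `RecedingDopplerBudget`: analysis along one null bicharacteristic, II

Helper file for the support item `stmt-FinalStateConjecture-15025`
(`Summit.FinalStateConjecture.FinalStateConjecture.Theses.ClusterCompleteness.RecedingDopplerBudget`).

Orientation and causality of the ray:

* a real-induction principle on a closed interval (`forall_Icc_of_step`);
* at a ray point of lab time `≥ 0` at most one attenuated term of `G` is active (two closed zones
  never meet, `zone_disjoint`), so the single-cone lemmas apply: `ẋ⁰ ≠ 0` for the nonzero null
  momentum and `ẋ` is `η`-causal (`velocity_zero_ne_zero_at`, `velocity_causal_at`);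
* **the ray is future-directed throughout** (`velocity_zero_pos`): `ẋ⁰ > 0` on `[0, S]` by real
  induction — it is positive at the flat start (`= −ξ₀(0)`), positivity is open by continuity, and
  at a limit parameter `ẋ⁰ ≥ 0` cannot vanish because lab time has stayed `≥ 0` there;
* consequently lab time is nondecreasing and `≥ 0` along the ray and **the ray is causal for `η`**:
  `‖x~(s₂) − x~(s₁)‖ ≤ x⁰(s₂) − x⁰(s₁)` for `s₁ ≤ s₂` (`causal_order`).
-/

noncomputable section

open Literature.Geometry.Lorentzian Set Filter
open scoped Topology InnerProductSpace

namespace Summit.FinalStateConjecture.FinalStateConjecture.Theorems.RecedingDoppler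

/-! ### Real induction on a closed interval -/

/-- **Real induction on `[a, b]`**: if `P a`, if truth of `P` on `[a, t]` (`t < b`) spreads to
some `[a, t']` with `t' > t`, and if truth on `[a, t)` (`t > a`) forces `P t`, then `P` holds on
`[a, b]` (least-upper-bound argument). [folklore] -/
theorem forall_Icc_of_step {P : ℝ → Prop} {a b : ℝ} (hab : a ≤ b) (h0 : P a)
    (hright : ∀ t ∈ Ico a b, (∀ σ ∈ Icc a t, P σ) → ∃ t' ∈ Ioc t b, ∀ σ ∈ Icc a t', P σ)
    (hleft : ∀ t ∈ Ioc a b, (∀ σ ∈ Ico a t, P σ) → P t) :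
    ∀ t ∈ Icc a b, P t := by
  set s : Set ℝ := {t | t ∈ Icc a b ∧ ∀ σ ∈ Icc a t, P σ} with hs
  have has : a ∈ s := ⟨⟨le_rfl, hab⟩, fun σ hσ ↦ by
    have : σ = a := le_antisymm hσ.2 hσ.1
    rw [this]; exact h0⟩
  have hne : s.Nonempty := ⟨a, has⟩
  have hbdd : BddAbove s := ⟨b, fun t ht ↦ ht.1.2⟩
  set c := sSup s with hc
  have hac : a ≤ c := le_csSup hbdd has
  have hcb : c ≤ b := csSup_le hne fun t ht ↦ ht.1.2
  have hlt : ∀ σ ∈ Ico a c, P σ := fun σ hσ ↦ by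
    obtain ⟨t, ht, hσt⟩ := exists_lt_of_lt_csSup hne hσ.2
    exact ht.2 σ ⟨hσ.1, hσt.le⟩
  have hPc : P c := by
    rcases eq_or_lt_of_le hac with h | h
    · rw [← h]; exact h0
    · exact hleft c ⟨h, hcb⟩ hlt
  have hQc : ∀ σ ∈ Icc a c, P σ := fun σ hσ ↦ by
    rcases eq_or_lt_of_le hσ.2 with h | h
    · rw [h]; exact hPc
    · exact hlt σ ⟨hσ.1, h⟩
  have hcb' : c = b := by
    by_contra hne'
    obtain ⟨t', ht', hQ⟩ := hright c ⟨hac, lt_of_le_of_ne hcb hne'⟩ hQc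
    have ht's : t' ∈ s := ⟨⟨hac.trans ht'.1.le, ht'.2⟩, hQ⟩
    have := le_csSup hbdd ht's
    linarith [ht'.1]
  intro t ht
  exact hQc t ⟨ht.1, hcb' ▸ ht.2⟩

section Ray

variable {N : ℕ} {M a : Fin N → ℝ} {Λ : Fin N → lorentzGroup} {p : Fin N → E3} {u : Fin N → E4}
  {q : Fin N → E4 → E4} {G : E4 → Fin 4 → Fin 4 → ℝ} {S : ℝ} {x ξ : ℝ → E4}

/-! ### At most one active term at ray points of lab time `≥ 0` -/

/-- **Two active attenuated terms at one event of lab time `≥ 0` belong to the same hole**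
(`radius_lt_of_coeff_ne_zero` + `zone_disjoint`). [folklore] -/
theorem active_unique (hM : ∀ i, 0 < M i) (ha : ∀ i, |a i| ≤ 1 / 10 * M i)
    (hu : ∀ i, u i = (Λ i : E4 ≃L[ℝ] E4) (E4.basisVector 0))
    (hv : ∀ i, 0 < u i 0 ∧ ‖E4.spatial (u i)‖ ≤ 1 / 10 * u i 0)
    (hq : ∀ i x, q i x = poincareInv (Λ i) (E4.ofTimeSpace 0 (p i)) x)
    (hsep : ∀ i j, i ≠ j → 1000 * (M i + M j) ≤ dist (p i) (p j) ∧
      0 < ⟪p i - p j, (u i 0)⁻¹ • E4.spatial (u i) - (u j 0)⁻¹ • E4.spatial (u j)⟫_ℝ)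
    {y : E4} (hy0 : 0 ≤ y 0) (i j : Fin N)
    (hi : Real.smoothTransition (2 - Kerr.radius (a i) (q i y) / (8 * M i)) *
      (2 * Kerr.scalarH (M i) (a i) (q i y)) ≠ 0)
    (hj : Real.smoothTransition (2 - Kerr.radius (a j) (q j y) / (8 * M j)) *
      (2 * Kerr.scalarH (M j) (a j) (q j y)) ≠ 0) : i = j :=
  zone_disjoint hM ha hu hv hq hsep hy0 (radius_lt_of_coeff_ne_zero (hM i) hi).le
    (radius_lt_of_coeff_ne_zero (hM j) hj).le

/-- **`ẋ⁰ ≠ 0` at a ray point of lab time `≥ 0`** with nonzero null momentum (single active cone,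
`velocity_zero_ne_zero_of_single`). [folklore] -/
theorem velocity_zero_ne_zero_at (hM : ∀ i, 0 < M i) (ha : ∀ i, |a i| ≤ 1 / 10 * M i)
    (hu : ∀ i, u i = (Λ i : E4 ≃L[ℝ] E4) (E4.basisVector 0))
    (hv : ∀ i, 0 < u i 0 ∧ ‖E4.spatial (u i)‖ ≤ 1 / 10 * u i 0)
    (hq : ∀ i x, q i x = poincareInv (Λ i) (E4.ofTimeSpace 0 (p i)) x)
    (hsep : ∀ i j, i ≠ j → 1000 * (M i + M j) ≤ dist (p i) (p j) ∧
      0 < ⟪p i - p j, (u i 0)⁻¹ • E4.spatial (u i) - (u j 0)⁻¹ • E4.spatial (u j)⟫_ℝ)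
    (hG : ∀ x μ ν, G x μ ν = Minkowski.bilin (E4.basisVector μ) (E4.basisVector ν) -
      ∑ i, Real.smoothTransition (2 - Kerr.radius (a i) (q i x) / (8 * M i)) *
        (2 * Kerr.scalarH (M i) (a i) (q i x)) *
        ((Λ i : E4 ≃L[ℝ] E4) (Kerr.nullVector (a i) (q i x))) μ *
        ((Λ i : E4 ≃L[ℝ] E4) (Kerr.nullVector (a i) (q i x))) ν)
    {y ζ : E4} (hy0 : 0 ≤ y 0) (hpos : ∀ i, 0 < Kerr.radius (a i) (q i y))
    (hnull : ∑ μ, ∑ ν, G y μ ν * ζ μ * ζ ν = 0) (hne : ζ ≠ 0) :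
    ∑ ν, G y 0 ν * ζ ν ≠ 0 :=
  velocity_zero_ne_zero_of_single
    (c := fun i x ↦ Real.smoothTransition (2 - Kerr.radius (a i) (q i x) / (8 * M i)) *
      (2 * Kerr.scalarH (M i) (a i) (q i x)))
    (L := fun i x ↦ (Λ i : E4 ≃L[ℝ] E4) (Kerr.nullVector (a i) (q i x))) hG
    (fun i ↦ coeff_nonneg (hM i).le (q i y))
    (fun i _ ↦ minkowski_boosted_nullVector (Λ i) (hpos i))
    (fun i j hi hj ↦ active_unique hM ha hu hv hq hsep hy0 i j hi hj) hnull hne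

/-- **`ẋ` is `η`-causal at a ray point of lab time `≥ 0`** with null momentum:
`∑ᵢ (ẋⁱ)² ≤ (ẋ⁰)²` (`velocity_causal_of_single`). [folklore] -/
theorem velocity_causal_at (hM : ∀ i, 0 < M i) (ha : ∀ i, |a i| ≤ 1 / 10 * M i)
    (hu : ∀ i, u i = (Λ i : E4 ≃L[ℝ] E4) (E4.basisVector 0))
    (hv : ∀ i, 0 < u i 0 ∧ ‖E4.spatial (u i)‖ ≤ 1 / 10 * u i 0)
    (hq : ∀ i x, q i x = poincareInv (Λ i) (E4.ofTimeSpace 0 (p i)) x)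
    (hsep : ∀ i j, i ≠ j → 1000 * (M i + M j) ≤ dist (p i) (p j) ∧
      0 < ⟪p i - p j, (u i 0)⁻¹ • E4.spatial (u i) - (u j 0)⁻¹ • E4.spatial (u j)⟫_ℝ)
    (hG : ∀ x μ ν, G x μ ν = Minkowski.bilin (E4.basisVector μ) (E4.basisVector ν) -
      ∑ i, Real.smoothTransition (2 - Kerr.radius (a i) (q i x) / (8 * M i)) *
        (2 * Kerr.scalarH (M i) (a i) (q i x)) *
        ((Λ i : E4 ≃L[ℝ] E4) (Kerr.nullVector (a i) (q i x))) μ *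
        ((Λ i : E4 ≃L[ℝ] E4) (Kerr.nullVector (a i) (q i x))) ν)
    {y ζ : E4} (hy0 : 0 ≤ y 0) (hpos : ∀ i, 0 < Kerr.radius (a i) (q i y))
    (hnull : ∑ μ, ∑ ν, G y μ ν * ζ μ * ζ ν = 0) :
    ∑ k : Fin 3, (∑ ν, G y k.succ ν * ζ ν) ^ 2 ≤ (∑ ν, G y 0 ν * ζ ν) ^ 2 :=
  velocity_causal_of_single
    (c := fun i x ↦ Real.smoothTransition (2 - Kerr.radius (a i) (q i x) / (8 * M i)) *
      (2 * Kerr.scalarH (M i) (a i) (q i x)))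
    (L := fun i x ↦ (Λ i : E4 ≃L[ℝ] E4) (Kerr.nullVector (a i) (q i x))) hG
    (fun i ↦ coeff_nonneg (hM i).le (q i y))
    (fun i _ ↦ minkowski_boosted_nullVector (Λ i) (hpos i))
    (fun i j hi hj ↦ active_unique hM ha hu hv hq hsep hy0 i j hi hj) hnull

/-! ### The ray is future-directed throughout -/

/-- Continuity of `s ↦ ẋ⁰(s) = ∑_ν G^{0ν}(x(s)) ξ_ν(s)` on `[0, S]`. [folklore] -/
theorem continuousOn_velocity_zero (hM : ∀ i, 0 < M i)
    (hq : ∀ i x, q i x = poincareInv (Λ i) (E4.ofTimeSpace 0 (p i)) x)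
    (hG : ∀ x μ ν, G x μ ν = Minkowski.bilin (E4.basisVector μ) (E4.basisVector ν) -
      ∑ i, Real.smoothTransition (2 - Kerr.radius (a i) (q i x) / (8 * M i)) *
        (2 * Kerr.scalarH (M i) (a i) (q i x)) *
        ((Λ i : E4 ≃L[ℝ] E4) (Kerr.nullVector (a i) (q i x))) μ *
        ((Λ i : E4 ≃L[ℝ] E4) (Kerr.nullVector (a i) (q i x))) ν)
    (hbi : KerrSchild.IsBicharacteristicOn G x ξ (Icc 0 S))
    (hhor : ∀ s ∈ Icc 0 S, ∀ i, Kerr.rPlus (M i) (a i) < Kerr.radius (a i) (q i (x s))) :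
    ContinuousOn (fun σ ↦ ∑ ν, G (x σ) 0 ν * ξ σ ν) (Icc 0 S) :=
  hbi.continuousOn_velocity_zero fun s hs ν ↦
    (contDiffAt_field hq hG (fun i ↦ radius_pos_of_horizon (hM i) (hhor s hs i)) 0 ν
      (n := 0)).continuousAt

/-- **The ray is future-directed throughout**: `ẋ⁰(s) > 0` for every `s ∈ [0, S]`
(real induction: positive at the flat start, open by continuity, and at a limit parameter lab time
is still `≥ 0`, so a single cone is active and the nonzero null momentum has `ẋ⁰ ≠ 0`). [folklore] -/
theorem velocity_zero_pos (hM : ∀ i, 0 < M i) (ha : ∀ i, |a i| ≤ 1 / 10 * M i)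
    (hu : ∀ i, u i = (Λ i : E4 ≃L[ℝ] E4) (E4.basisVector 0))
    (hv : ∀ i, 0 < u i 0 ∧ ‖E4.spatial (u i)‖ ≤ 1 / 10 * u i 0)
    (hq : ∀ i x, q i x = poincareInv (Λ i) (E4.ofTimeSpace 0 (p i)) x)
    (hsep : ∀ i j, i ≠ j → 1000 * (M i + M j) ≤ dist (p i) (p j) ∧
      0 < ⟪p i - p j, (u i 0)⁻¹ • E4.spatial (u i) - (u j 0)⁻¹ • E4.spatial (u j)⟫_ℝ)
    (hG : ∀ x μ ν, G x μ ν = Minkowski.bilin (E4.basisVector μ) (E4.basisVector ν) -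
      ∑ i, Real.smoothTransition (2 - Kerr.radius (a i) (q i x) / (8 * M i)) *
        (2 * Kerr.scalarH (M i) (a i) (q i x)) *
        ((Λ i : E4 ≃L[ℝ] E4) (Kerr.nullVector (a i) (q i x))) μ *
        ((Λ i : E4 ≃L[ℝ] E4) (Kerr.nullVector (a i) (q i x))) ν)
    (hbi : KerrSchild.IsBicharacteristicOn G x ξ (Icc 0 S))
    (hhor : ∀ s ∈ Icc 0 S, ∀ i, Kerr.rPlus (M i) (a i) < Kerr.radius (a i) (q i (x s)))
    (hnull0 : ∑ μ, ∑ ν, G (x 0) μ ν * ξ 0 μ * ξ 0 ν = 0)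
    (hfar0 : ∀ i, 16 * M i ≤ Kerr.radius (a i) (q i (x 0))) (hE0 : 0 < -(ξ 0 0))
    (ht0 : 0 ≤ x 0 0) :
    ∀ s ∈ Icc 0 S, 0 < ∑ ν, G (x s) 0 ν * ξ s ν := by
  by_cases hS : 0 ≤ S
  swap
  · intro s hs; exact absurd (hs.1.trans hs.2) hS
  have hcont := continuousOn_velocity_zero hM hq hG hbi hhor
  have hnull := null_on hM hq hG hbi hhor hnull0 hS
  have hne := momentum_ne_zero hM hq hG hbi hhor hE0
  refine forall_Icc_of_step hS ?_ ?_ ?_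
  · -- start: flat, `ẋ⁰ = −ξ₀ > 0`
    rw [velocity_zero_of_flat' hM hG hfar0]
    exact hE0
  · -- openness by continuity
    intro t ht hP
    have hev : ∀ᶠ σ in 𝓝[Icc 0 S] t, 0 < ∑ ν, G (x σ) 0 ν * ξ σ ν :=
      (hcont t ⟨ht.1, ht.2.le⟩).eventually (lt_mem_nhds (hP t ⟨ht.1, le_rfl⟩))
    obtain ⟨δ, hδ, hδP⟩ := Metric.mem_nhdsWithin_iff.mp hev
    refine ⟨min (t + δ / 2) S, ⟨lt_min (by linarith) ht.2, min_le_right _ _⟩, fun σ hσ ↦ ?_⟩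
    by_cases hσt : σ ≤ t
    · exact hP σ ⟨hσ.1, hσt⟩
    · push Not at hσt
      refine hδP ⟨?_, hσ.1, hσ.2.trans (min_le_right _ _)⟩
      rw [Metric.mem_ball, Real.dist_eq, abs_of_pos (by linarith)]
      linarith [hσ.2.trans (min_le_left _ _)]
  · -- closedness: at a limit parameter `ẋ⁰ ≥ 0` and `≠ 0`
    intro t ht hP
    have htS : t ∈ Icc 0 S := ⟨ht.1.le, ht.2⟩
    -- `ẋ⁰(t) ≥ 0`
    have hge : 0 ≤ ∑ ν, G (x t) 0 ν * ξ t ν := by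
      by_contra hneg
      push Not at hneg
      have hev : ∀ᶠ σ in 𝓝[Icc 0 S] t, ∑ ν, G (x σ) 0 ν * ξ σ ν < 0 :=
        (hcont t htS).eventually (gt_mem_nhds hneg)
      obtain ⟨δ, hδ, hδP⟩ := Metric.mem_nhdsWithin_iff.mp hev
      set ε := min (δ / 2) (t / 2) with hε
      have hεpos : 0 < ε := lt_min (by linarith) (by linarith [ht.1])
      have hσ : t - ε ∈ Ico 0 t := ⟨by linarith [min_le_right (δ / 2) (t / 2)], by linarith⟩
      have h1 := hP (t - ε) hσ
      have h2 : ∑ ν, G (x (t - ε)) 0 ν * ξ (t - ε) ν < 0 := by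
        refine hδP ⟨?_, hσ.1, by linarith [ht.2]⟩
        rw [Metric.mem_ball, Real.dist_eq, abs_of_nonpos (by linarith)]
        linarith [min_le_left (δ / 2) (t / 2)]
      linarith
    -- lab time at `t` is `≥ 0`: monotone on `[0, t)` and continuous
    have hx0 : 0 ≤ x t 0 := by
      have hmono : StrictMonoOn (fun σ ↦ x σ 0) (Ico 0 t) :=
        (hbi.mono (Ico_subset_Icc_self.trans (Icc_subset_Icc le_rfl ht.2))).strictMonoOn_time
          (convex_Ico 0 t) hP
      have hev : ∀ᶠ σ in 𝓝[<] t, x 0 0 ≤ x σ 0 := by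
        have h1 : ∀ᶠ σ in 𝓝[<] t, σ ∈ Ioo 0 t := Ioo_mem_nhdsLT ht.1
        refine h1.mono fun σ hσ ↦ ?_
        exact (hmono.le_iff_le ⟨le_rfl, ht.1⟩ ⟨hσ.1.le, hσ.2⟩).2 hσ.1.le
      have hct : Tendsto (fun σ ↦ x σ 0) (𝓝[<] t) (𝓝 (x t 0)) :=
        ((hbi.position t htS 0).continuousAt.tendsto).mono_left nhdsWithin_le_nhds
      exact ht0.trans (ge_of_tendsto hct hev)
    have hne' := velocity_zero_ne_zero_at hM ha hu hv hq hsep hG hx0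
      (fun i ↦ radius_pos_of_horizon (hM i) (hhor t htS i)) (hnull t htS) (hne t htS)
    exact lt_of_le_of_ne hge (Ne.symm hne')

/-- **Lab time is nondecreasing along the ray** and `≥ 0`. [folklore] -/
theorem time_mono (hM : ∀ i, 0 < M i) (ha : ∀ i, |a i| ≤ 1 / 10 * M i)
    (hu : ∀ i, u i = (Λ i : E4 ≃L[ℝ] E4) (E4.basisVector 0))
    (hv : ∀ i, 0 < u i 0 ∧ ‖E4.spatial (u i)‖ ≤ 1 / 10 * u i 0)
    (hq : ∀ i x, q i x = poincareInv (Λ i) (E4.ofTimeSpace 0 (p i)) x)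
    (hsep : ∀ i j, i ≠ j → 1000 * (M i + M j) ≤ dist (p i) (p j) ∧
      0 < ⟪p i - p j, (u i 0)⁻¹ • E4.spatial (u i) - (u j 0)⁻¹ • E4.spatial (u j)⟫_ℝ)
    (hG : ∀ x μ ν, G x μ ν = Minkowski.bilin (E4.basisVector μ) (E4.basisVector ν) -
      ∑ i, Real.smoothTransition (2 - Kerr.radius (a i) (q i x) / (8 * M i)) *
        (2 * Kerr.scalarH (M i) (a i) (q i x)) *
        ((Λ i : E4 ≃L[ℝ] E4) (Kerr.nullVector (a i) (q i x))) μ *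
        ((Λ i : E4 ≃L[ℝ] E4) (Kerr.nullVector (a i) (q i x))) ν)
    (hbi : KerrSchild.IsBicharacteristicOn G x ξ (Icc 0 S))
    (hhor : ∀ s ∈ Icc 0 S, ∀ i, Kerr.rPlus (M i) (a i) < Kerr.radius (a i) (q i (x s)))
    (hnull0 : ∑ μ, ∑ ν, G (x 0) μ ν * ξ 0 μ * ξ 0 ν = 0)
    (hfar0 : ∀ i, 16 * M i ≤ Kerr.radius (a i) (q i (x 0))) (hE0 : 0 < -(ξ 0 0))
    (ht0 : 0 ≤ x 0 0) {s₁ s₂ : ℝ} (hs₁ : s₁ ∈ Icc 0 S) (hs₂ : s₂ ∈ Icc 0 S) (h : s₁ ≤ s₂) :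
    x s₁ 0 ≤ x s₂ 0 ∧ 0 ≤ x s₁ 0 := by
  have hmono : StrictMonoOn (fun σ ↦ x σ 0) (Icc 0 S) :=
    hbi.strictMonoOn_time (convex_Icc 0 S)
      (velocity_zero_pos hM ha hu hv hq hsep hG hbi hhor hnull0 hfar0 hE0 ht0)
  exact ⟨(hmono.le_iff_le hs₁ hs₂).2 h,
    ht0.trans ((hmono.le_iff_le ⟨le_rfl, hs₁.1.trans hs₁.2⟩ hs₁).2 hs₁.1)⟩

/-! ### The ray is causal for `η` -/

/-- **The spatial displacement of the ray is bounded by the elapsed lab time**: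
`‖x~(s₂) − x~(s₁)‖ ≤ x⁰(s₂) − x⁰(s₁)` for `0 ≤ s₁ ≤ s₂ ≤ S` (pointwise `‖ẋ~‖ ≤ ẋ⁰`, integrated
along every fixed spatial direction). [folklore] -/
theorem causal_order (hM : ∀ i, 0 < M i) (ha : ∀ i, |a i| ≤ 1 / 10 * M i)
    (hu : ∀ i, u i = (Λ i : E4 ≃L[ℝ] E4) (E4.basisVector 0))
    (hv : ∀ i, 0 < u i 0 ∧ ‖E4.spatial (u i)‖ ≤ 1 / 10 * u i 0)
    (hq : ∀ i x, q i x = poincareInv (Λ i) (E4.ofTimeSpace 0 (p i)) x)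
    (hsep : ∀ i j, i ≠ j → 1000 * (M i + M j) ≤ dist (p i) (p j) ∧
      0 < ⟪p i - p j, (u i 0)⁻¹ • E4.spatial (u i) - (u j 0)⁻¹ • E4.spatial (u j)⟫_ℝ)
    (hG : ∀ x μ ν, G x μ ν = Minkowski.bilin (E4.basisVector μ) (E4.basisVector ν) -
      ∑ i, Real.smoothTransition (2 - Kerr.radius (a i) (q i x) / (8 * M i)) *
        (2 * Kerr.scalarH (M i) (a i) (q i x)) *
        ((Λ i : E4 ≃L[ℝ] E4) (Kerr.nullVector (a i) (q i x))) μ *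
        ((Λ i : E4 ≃L[ℝ] E4) (Kerr.nullVector (a i) (q i x))) ν)
    (hbi : KerrSchild.IsBicharacteristicOn G x ξ (Icc 0 S))
    (hhor : ∀ s ∈ Icc 0 S, ∀ i, Kerr.rPlus (M i) (a i) < Kerr.radius (a i) (q i (x s)))
    (hnull0 : ∑ μ, ∑ ν, G (x 0) μ ν * ξ 0 μ * ξ 0 ν = 0)
    (hfar0 : ∀ i, 16 * M i ≤ Kerr.radius (a i) (q i (x 0))) (hE0 : 0 < -(ξ 0 0))
    (ht0 : 0 ≤ x 0 0) {s₁ s₂ : ℝ} (hs₁ : s₁ ∈ Icc 0 S) (hs₂ : s₂ ∈ Icc 0 S) (h : s₁ ≤ s₂) :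
    ‖E4.spatial (x s₂) - E4.spatial (x s₁)‖ ≤ x s₂ 0 - x s₁ 0 := by
  have hS : 0 ≤ S := hs₁.1.trans hs₁.2
  have hpos := velocity_zero_pos hM ha hu hv hq hsep hG hbi hhor hnull0 hfar0 hE0 ht0
  have hnull := null_on hM hq hG hbi hhor hnull0 hS
  -- along every spatial direction `e` with `‖e‖ ≤ 1`, `σ ↦ x⁰(σ) − ⟪e, x~(σ)⟫` is monotone
  have hdir : ∀ e : E3, ‖e‖ ≤ 1 →
      ⟪e, E4.spatial (x s₂) - E4.spatial (x s₁)⟫_ℝ ≤ x s₂ 0 - x s₁ 0 := by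
    intro e he
    set g : ℝ → ℝ := fun σ ↦ x σ 0 - ⟪e, E4.spatial (x σ)⟫_ℝ with hg
    -- derivative of `g`
    have hderiv : ∀ σ ∈ Icc 0 S, HasDerivAt g
        ((∑ ν, G (x σ) 0 ν * ξ σ ν) -
          ⟪e, E4.spatial (∑ μ, (∑ ν, G (x σ) μ ν * ξ σ ν) • E4.basisVector μ)⟫_ℝ) σ := by
      intro σ hσ
      have h1 := hbi.position σ hσ 0
      have h2 := hbi.hasDerivAt_position_vec hσ
      have h3 : HasDerivAt (fun τ ↦ E4.spatial (x τ))
          (E4.spatial (∑ μ, (∑ ν, G (x σ) μ ν * ξ σ ν) • E4.basisVector μ)) σ :=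
        E4.spatial.hasFDerivAt.comp_hasDerivAt σ h2
      have h4 : HasDerivAt (fun τ ↦ ⟪e, E4.spatial (x τ)⟫_ℝ)
          (⟪e, E4.spatial (∑ μ, (∑ ν, G (x σ) μ ν * ξ σ ν) • E4.basisVector μ)⟫_ℝ) σ := by
        have := (innerSL ℝ e).hasFDerivAt.comp_hasDerivAt σ h3
        simpa only [Function.comp_def, innerSL_apply_apply] using this
      exact h1.sub h4
    -- nonnegativity of the derivative
    have hnonneg : ∀ σ ∈ Icc 0 S, 0 ≤ (∑ ν, G (x σ) 0 ν * ξ σ ν) -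
        ⟪e, E4.spatial (∑ μ, (∑ ν, G (x σ) μ ν * ξ σ ν) • E4.basisVector μ)⟫_ℝ := by
      intro σ hσ
      set V : E4 := ∑ μ, (∑ ν, G (x σ) μ ν * ξ σ ν) • E4.basisVector μ with hV
      have hx0 := (time_mono hM ha hu hv hq hsep hG hbi hhor hnull0 hfar0 hE0 ht0 hσ hσ le_rfl).2
      have hc := velocity_causal_at hM ha hu hv hq hsep hG hx0
        (fun i ↦ radius_pos_of_horizon (hM i) (hhor σ hσ i)) (hnull σ hσ)
      have hVk : ∀ k : Fin 3, E4.spatial V k = ∑ ν, G (x σ) k.succ ν * ξ σ ν := by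
        intro k
        rw [E4.spatial_apply, hV, KerrSchild.sum_smul_basisVector_apply]
      have hnorm : ‖E4.spatial V‖ ^ 2 = ∑ k : Fin 3, (∑ ν, G (x σ) k.succ ν * ξ σ ν) ^ 2 := by
        rw [EuclideanSpace.real_norm_sq_eq]
        exact Finset.sum_congr rfl fun k _ ↦ by rw [hVk]
      have hle : ‖E4.spatial V‖ ≤ ∑ ν, G (x σ) 0 ν * ξ σ ν := by
        refine (sq_le_sq₀ (norm_nonneg _) (hpos σ hσ).le).mp ?_
        rw [hnorm]; exact hc
      have hcs : ⟪e, E4.spatial V⟫_ℝ ≤ ‖e‖ * ‖E4.spatial V‖ := real_inner_le_norm _ _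
      have : ‖e‖ * ‖E4.spatial V‖ ≤ 1 * ‖E4.spatial V‖ :=
        mul_le_mul_of_nonneg_right he (norm_nonneg _)
      linarith
    -- monotonicity
    have hmono : MonotoneOn g (Icc 0 S) := by
      refine monotoneOn_of_deriv_nonneg (convex_Icc 0 S)
        (fun σ hσ ↦ (hderiv σ hσ).continuousAt.continuousWithinAt)
        (fun σ hσ ↦ (hderiv σ (interior_subset hσ)).differentiableAt.differentiableWithinAt)
        fun σ hσ ↦ ?_
      rw [(hderiv σ (interior_subset hσ)).deriv]
      exact hnonneg σ (interior_subset hσ)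
    have := hmono hs₁ hs₂ h
    simp only [hg] at this
    rw [inner_sub_right]
    linarith
  -- choose the direction of the displacement
  set d : E3 := E4.spatial (x s₂) - E4.spatial (x s₁) with hd
  by_cases hd0 : d = 0
  · rw [hd0, norm_zero]
    have := hdir 0 (by simp)
    rw [inner_zero_left] at this
    exact this
  · have hdn : 0 < ‖d‖ := norm_pos_iff.2 hd0
    have h1 := hdir (‖d‖⁻¹ • d) (by rw [norm_smul, norm_inv, norm_norm, inv_mul_cancel₀ hdn.ne'])
    rw [real_inner_smul_left, real_inner_self_eq_norm_sq] at h1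
    have : ‖d‖⁻¹ * ‖d‖ ^ 2 = ‖d‖ := by field_simp
    linarith [this]

end Ray

end Summit.FinalStateConjecture.FinalStateConjecture.Theorems.RecedingDoppler

end
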